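import Summits.Ventures.YMGap.RobustBall.LocalSourceOneState
import Summits.Ventures.YMGap.RobustBall.LocalSourceOneStateS
import HarnessLib

/-!
# Venture statement — YMGap (cell `pub-ymgap`) — CONJUNCT BODIES T69, T70 (V23B, block 1)

STATUS: FILED by p3 g9 as V23B = T69 + T70 ALONE on the lead's ★ R319 V23B BOOKING (lead g10, bus 2026-08-24T14:29:57Z, quoted verbatim: «p3 files
`Summits/Ventures/YMGap/StatementConjunctsV23B.lean` = T69 `T69_LocalSourceNoPhase` + T70 `T70_TierTwoLocalSourceNoPhase` ALONE (candidate 11ff8a8b14f05abc, 81 l …) … do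
NOT hold for T65c … or T66a–e/T66 … — they open V23C at their own GREEN»); the parents' oleans (`RobustBall/LocalSourceOneState{,S}`) answered by-import rc 0 / std axioms
at 14:29–14:31Z 2026-08-24. Numbers by lead g9 R311 (2) (bus 2026-08-24T04:13:31Z): «T69 = `T69_LocalSourceNoPhase` (T_M) and T70 = `T70_TierTwoLocalSourceNoPhase` (T_N)
… they RIDE IN V23 iff p3's by-import read of the split copy returns rc 0 / std axioms BEFORE the final-sha line, else they are V23B's first rows» — the parents' oleans
(`RobustBall/LocalSourceOneState{,S}`, tree files since 2026-08-23 23:33Z, commit 8138d0beb6ad) were still unbuilt at V23's final-sha line (2026-08-24T07:22Z), so V23 =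
T64 alone (`StatementConjunctsV23.lean`, p376180) and these two texts open V23B. Texts, VERBATIM from the owner file: rb-p1 g7 `HOME/pub-ymgap-rb-p1/T-texts-rbp1g7.lean`
7c7632b7c5f3ac35, texts `T_M` / `T_N` = the split copy `HOME/lean/v23-prestage-p3/owners/T-texts-rbp1g7-MN.lean` cb084aec3150a36a (the file's other texts `T_O`–`T_S` wait
for their parent files and for numbers).  Only decl names change (map `HOME/lean/v23-prestage-p3/RENAMES-V23-ADD-T69T70.txt`); ONE added line `open
Summit.Ventures.YMGap.RobustBall` + TWO added `/-- … -/` docstrings on the `_holds` witnesses (gate docstring lint; the owner file has none there) (the owner file resolved those names through its own `namespace …RobustBall.TTexts`, which the block format strips); T69/T70 are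
top-level numbers (no consolidator); built mechanically by `HOME/lean/v23-prestage-p3/mkmono23.py`; byte-compare `bytecmp.py --map` = verbatim-modulo-map.  LATER ROWS
(R319): T65c (ds-4), T66a–e/T66 (ds-3), T67a–d + T68a (rb-p2) and T71+ open `StatementConjunctsV23C` / V24 when their parent modules are tree files AND built (R294
numbered-PENDING discipline).

HONEST FRAMING. WHAT THIS IS: bodies `Tk_… : Prop` + witnesses `Tk_…_holds`, kernel-checked with NO hypothesis, closing by TREE constants only. STRONG-COUPLING LATTICE
statements: a LOCAL source term of any strength (one Wilson loop `t · Re tr U_w/2` at the `SU(2)` Wilson point `0 ≤ β_W ≤ 1/3`; a bounded source with finitely many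
listed terms on the tier-2 weighted ball) does not create a phase — the modified action still has exactly ONE DLR state.  The windows are where a one-link Dobrushin /
tilt bound closes, not transitions.  WHAT THIS IS NOT: nothing about large sources with infinitely many terms, the crossover, a continuum limit, confinement in the
continuum, or the Yang–Mills Millennium problem.
-/

noncomputable section

namespace Summit.Ventures.YMGap

/-! ### OWNER FILE `lean/v23-prestage-p3/owners/T-texts-rbp1g7-MN.lean` (sha16 cb084aec3150a36a) — section `V23B_rbp1_LocalSourceMN` -/
section V23B_rbp1_LocalSourceMN

open Summit.Ventures.YMGap.RobustBall

/-!
# T-text CANDIDATES (rb-p1 g7) for p3 / the lead — the «local source» package, `SU(2)` on `ℤ⁴` and every `N ≥ 2`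
(NOT a tree file; statement texts + `_holds` proofs; `T_M`/`T_N` are backed by LANDED files (LocalSourceOneState 8138d0beb6ad,
LocalSourceOneStateS 8138d0beb6ad), `T_O`–`T_S` by STAGED files (LocalSourceResponseBall / LocalSourceAnalytic / LocalSourceWilson /
LocalSourceGaugeBall / LocalSourceLoopBall) — quotable only after those land.  Honest label: strong-coupling lattice statements about LOCAL couplings with finitely
many terms; rates are comparison lower bounds; nothing continuum / Clay.)
-/


open MeasureTheory Function Finset Real ProbabilityTheory
open scoped NNReal
open Literature.Probability.LatticeModels
open Literature.MathematicalPhysics.QuantumLattice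
open Literature.MathematicalPhysics.QuantumFieldTheory hiding ZdEdge Site


/-- **T_M (LOCAL SOURCES CREATE NO PHASE at the `SU(2)` Wilson point, `0 ≤ β_W ≤ 1/3`)**: for every closed lattice walk `w` in `ℤ⁴` and every real
`t`, the `SU(2)` Wilson action at `β_W` (bare coupling `β_W/2`) with the loop source `t · Re tr U_w/2` inserted has EXACTLY ONE DLR state. -/
def T69_LocalSourceNoPhase : Prop :=
  ∀ βW : ℝ, 0 ≤ βW → βW ≤ 1 / 3 → ∀ (x : Literature.Probability.LatticeModels.Site 4) (w : (zdGraph 4).Walk x x) (t : ℝ),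
    HasUniqueGibbsMeasure (perturbedYM (d := 4) (fundamentalRep (Fin 2)) (2 * (βW / 4))
      (loopFamilyAction 2 (fun _ : Unit => (⟨x, w⟩ : ZdLoop 4)) (fun _ => t)) (loopSupp (fun _ : Unit => (⟨x, w⟩ : ZdLoop 4))))

/-- `T69_LocalSourceNoPhase` holds: witness `RobustBall.su2_wilson_singleLoop_hasUniqueGibbsMeasure_upTo_oneThird` (rb-p1 g7, `LocalSourceOneState`). [docstring added by p3 for the gate's docstring lint; statement and proof are the owner's bytes] -/
theorem T69_LocalSourceNoPhase_holds : T69_LocalSourceNoPhase := fun _ h0 h1 _ w t =>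
  su2_wilson_singleLoop_hasUniqueGibbsMeasure_upTo_oneThird h0 h1 w t

/-- **T_N (TIER 2: a bounded local source creates no phase on the weighted ball)**: `t > 0`, `6|β_W| e^{a} e^{t} + e^{a/2} √(2/3) Λ < 1` ⇒ every member
of `MemBallZdS a Λ t` plus every source with continuous own-link terms and finitely many listed terms has exactly one DLR state of the summable
specification. -/
def T70_TierTwoLocalSourceNoPhase : Prop :=
  ∀ (βW a Λ t : ℝ), 0 < t → 6 * |βW| * (exp a * exp t) + exp (a / 2) * Real.sqrt (2 / 3) * Λ < 1 →
    ∀ (W : Potential (ZdEdge 4) (SUN 2)), MemBallZdS a Λ t W →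
    ∀ (V : Potential (ZdEdge 4) (SUN 2)), (∀ X, Continuous (V X)) → (∀ X, DependsOn (V X) (↑X : Set (ZdEdge 4))) →
    ∀ (suppV : Finset (ZdEdge 4) → Finset (Finset (ZdEdge 4))), V.IsSupportedBy suppV →
    ∀ (T : Finset (Finset (ZdEdge 4))), (∀ Λ', suppV Λ' ⊆ T) →
      HasUniqueGibbsMeasure (perturbedYMS (d := 4) (fundamentalRep (Fin 2)) (2 * (βW / 4)) (W + V))

/-- `T70_TierTwoLocalSourceNoPhase` holds: witness `RobustBall.su2_tier2_add_source_hasUniqueGibbsMeasure_dim4` (rb-p1 g7, `LocalSourceOneStateS`). [docstring added by p3 for the gate's docstring lint; statement and proof are the owner's bytes] -/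
theorem T70_TierTwoLocalSourceNoPhase_holds : T70_TierTwoLocalSourceNoPhase := fun _ _ _ _ ht hρ _ hW _ hVc hVdep _ hsuppV _ hT =>
  su2_tier2_add_source_hasUniqueGibbsMeasure_dim4 ht hρ hW hVc hVdep hsuppV hT



end V23B_rbp1_LocalSourceMN

end Summit.Ventures.YMGap

end
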